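import Summits.CriticalPhenomena.PercolationContinuityZ3.Theorems.SahiMasterFamilyExplicitMinorDomination

/-!
# Explicit minor domination at order 3 is ONE inequality: `mixC1 − E_3(U⁰) = (mixC2 − E_3(U¹)) + ν_0ν_1ν_2`

Unit `prim-master-conj` (crux anchor stmt-CriticalPhenomena-4575, helper work), gen 19; memo
`run/shared/lean/prim/prim-l12/prim-master-conj/POINTWISE.md` §20.  Notation as in gen 18's `…ExplicitMinorDomination`: along a coordinate `e`,
`t = p_e`, `s = 1 − t`, `P = U⁰ = (secAt e false U_j)_j ⊆ Q = U¹ = (secAt e true U_j)_j`, `ν_j = μ(Q_j) − μ(P_j)`, `E⁰ = E_3(μ;1_P)`, `E¹ = E_3(μ;1_Q)`;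
P3's one-coordinate Bernstein form is `E_3(μ_p;1_U) = s³E⁰ + s²t·mixC1 + st²·mixC2 + t³E¹` (so `3B_1 = mixC1`, `3B_2 = mixC2`), and gen 18 showed
`MD_3` at `(U,e)` for every `p_e` ⟺ the TWO endpoint inequalities `mixC1 ≥ E⁰`, `mixC2 ≥ E¹` (`sahiE_three_ge_sq_minors_of_mixC_ge`).

THIS FILE (all proved, axioms standard):
* `mixC1_sub_sahiE_eq` — for EVERY weight `μ` and EVERY pair of triples `P, Q` (a polynomial identity in the fourteen moments):
  `mixC1 − E_3(1_P) = (mixC2 − E_3(1_Q)) + Π_j (μ(Q_j) − μ(P_j))`.  So for nested sections (`ν_j ≥ 0`) the `t → 0` endpoint inequality FOLLOWS from the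
  `t → 1` one: **`MD_3` at `(U, e)` for every `p_e` ⟺ the single inequality `Λ_e(U) := mixC2_e(U) − E_3(U^{e←1}) ≥ 0`**
  (`sahiE_three_ge_sq_minors_of_mixC2_ge`; in Bernstein language `3B_1 − B_0 = (3B_2 − B_3) + ν_0ν_1ν_2`).
* `mixC2_sub_sahiE_eq` — the explicit form of `Λ`:
  `Λ = E_3(1_P) + E_3(1_Q) + Σ_i ν_i·[Cov(Q_j,Q_k) − Cov(P_j,P_k)] + Σ_i μ(P_i)·ν_jν_k + ν_0ν_1ν_2`  (`{i,j,k} = {0,1,2}`),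
  whose only signed terms are `−ν_i·Cov(P_j,P_k)`; equivalently (`sahiE_three_eq_chord_add`) the exact one-coordinate expansion
  `E_3(μ_p;1_U) = s·E⁰ + t·E¹ + st·[D + (2 − t)·ν_0ν_1ν_2]`, `D = Λ − E⁰ − E¹ − ν_0ν_1ν_2` (gen 14's chord defect `G_e = D + (2−t)ν_0ν_1ν_2` made explicit).
* REDUCTIONS with the single hypothesis: `masterFamilyNonneg_three_of_mixC2_ge` — `Λ ≥ 0` for every increasing triple on every finite cube, every
  coordinate, every parameter ⟹ `MasterFamilyNonneg 3` (Kahn's Conjecture 5 / Sahi's `C_3` for product measures); `masterFamilyEqIff_three_of_mixC2_ge` —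
  the same at interior parameters ⟹ `MasterFamilyEqIff 3` (the pointwise master conjecture at order 3).
EVIDENCE for `Λ ≥ 0` (= gen 18's `MD_3` census, exact): all triples of up-sets on ≤ 4 coordinates × all coordinates × 7 parameter vectors (22.1 M checks),
52.5 M random checks on 5 coordinates, 8.4 M on 6, 0.7 M on 7: no violation; `Λ` is moreover numerically 2-dominated along a second coordinate (gen 19,
4,500 exact checks, needed exponent ≤ 1.44), while the full `(2 ∓ ∂)`-tower fails already on 3 coordinates (`(Maj₃, OR₃, OR₃)`).
HONEST FRAMING: identities and reductions; `Λ ≥ 0`, `C_3`, `MasterFamilyEqIff 3` remain OPEN. [this work]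
-/

noncomputable section

open scoped Classical

namespace Summit.CriticalPhenomena.PercolationContinuityZ3.Theorems

open Finset Function
open Literature.Combinatorics.Sahi2008
open Literature.Probability.Percolation.DecisionTree (ind)
open SahiCombMix

namespace Pointwise

variable {ι : Type} [Fintype ι]

/-! ### 1. The two endpoint functionals differ by `ν_0ν_1ν_2` (any weight, any two triples) -/

/-- **`mixC1 − E_3(P) = (mixC2 − E_3(Q)) + Π_j (μ(Q_j) − μ(P_j))`** — a polynomial identity in the moments of `P` and of `Q`, valid for every weight `μ`
and every pair of triples of events (no nesting, no monotonicity, no product structure needed). [this work] -/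
theorem mixC1_sub_sahiE_eq (μ : Set ι → ℝ) (P Q : Fin 3 → Set (Set ι)) :
    mixC1 μ P Q - sahiE μ 3 (fun j => ind (P j))
      = (mixC2 μ P Q - sahiE μ 3 (fun j => ind (Q j)))
        + (ex μ (ind (Q 0)) - ex μ (ind (P 0))) * (ex μ (ind (Q 1)) - ex μ (ind (P 1))) * (ex μ (ind (Q 2)) - ex μ (ind (P 2))) := by
  rw [mixC1, mixC2, sahiE_three_apply, sahiE_three_apply]
  ring

/-- **The explicit form of `Λ = mixC2 − E_3(Q)`**: with `ν_j = μ(Q_j) − μ(P_j)` and `Cov(X,Y) = μ(XY) − μXμY`,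
`Λ = E_3(P) + E_3(Q) + Σ_i ν_i [Cov(Q_j,Q_k) − Cov(P_j,P_k)] + Σ_i μ(P_i) ν_j ν_k + ν_0 ν_1 ν_2` (any weight, any two triples). [this work] -/
theorem mixC2_sub_sahiE_eq (μ : Set ι → ℝ) (P Q : Fin 3 → Set (Set ι)) :
    mixC2 μ P Q - sahiE μ 3 (fun j => ind (Q j))
      = sahiE μ 3 (fun j => ind (P j)) + sahiE μ 3 (fun j => ind (Q j))
        + (ex μ (ind (Q 0)) - ex μ (ind (P 0))) *
            ((ex μ (ind (Q 1) * ind (Q 2)) - ex μ (ind (Q 1)) * ex μ (ind (Q 2))) - (ex μ (ind (P 1) * ind (P 2)) - ex μ (ind (P 1)) * ex μ (ind (P 2))))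
        + (ex μ (ind (Q 1)) - ex μ (ind (P 1))) *
            ((ex μ (ind (Q 0) * ind (Q 2)) - ex μ (ind (Q 0)) * ex μ (ind (Q 2))) - (ex μ (ind (P 0) * ind (P 2)) - ex μ (ind (P 0)) * ex μ (ind (P 2))))
        + (ex μ (ind (Q 2)) - ex μ (ind (P 2))) *
            ((ex μ (ind (Q 0) * ind (Q 1)) - ex μ (ind (Q 0)) * ex μ (ind (Q 1))) - (ex μ (ind (P 0) * ind (P 1)) - ex μ (ind (P 0)) * ex μ (ind (P 1))))
        + ex μ (ind (P 0)) * (ex μ (ind (Q 1)) - ex μ (ind (P 1))) * (ex μ (ind (Q 2)) - ex μ (ind (P 2)))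
        + ex μ (ind (P 1)) * (ex μ (ind (Q 0)) - ex μ (ind (P 0))) * (ex μ (ind (Q 2)) - ex μ (ind (P 2)))
        + ex μ (ind (P 2)) * (ex μ (ind (Q 0)) - ex μ (ind (P 0))) * (ex μ (ind (Q 1)) - ex μ (ind (P 1)))
        + (ex μ (ind (Q 0)) - ex μ (ind (P 0))) * (ex μ (ind (Q 1)) - ex μ (ind (P 1))) * (ex μ (ind (Q 2)) - ex μ (ind (P 2))) := by
  rw [mixC2, sahiE_three_apply, sahiE_three_apply]
  ring

/-- **The exact one-coordinate expansion around the chord**: for an increasing triple `U` and `t = p_e`,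
`E_3(μ_p;1_U) = (1−t)·E⁰ + t·E¹ + t(1−t)·[(mixC2 − E⁰ − 2E¹) + (1−t)·ν_0ν_1ν_2]`, where `mixC2 − E⁰ − 2E¹ = D`, `D = Λ − E⁰ − E¹ − ν_0ν_1ν_2`
is the `ν·ΔCov + μ(P)νν` part of `mixC2_sub_sahiE_eq` (gen 14's chord defect is `G_e = D + (2 − t)ν_0ν_1ν_2`). [this work] -/
theorem sahiE_three_eq_chord_add (e : ι) (U : Fin 3 → Set (Set ι)) (hU : ∀ j, IsUpperSet (U j)) (p : ι → unitInterval) :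
    sahiE (bernoulliWeight p) 3 (fun j => ind (U j))
      = (1 - (p e : ℝ)) * sahiE (bernoulliWeight p) 3 (fun j => ind (secAt e false (U j)))
        + (p e : ℝ) * sahiE (bernoulliWeight p) 3 (fun j => ind (secAt e true (U j)))
        + (p e : ℝ) * (1 - (p e : ℝ)) *
          ((mixC2 (bernoulliWeight p) (fun j => secAt e false (U j)) (fun j => secAt e true (U j))
              - sahiE (bernoulliWeight p) 3 (fun j => ind (secAt e false (U j)))
              - 2 * sahiE (bernoulliWeight p) 3 (fun j => ind (secAt e true (U j))))
            + (1 - (p e : ℝ)) *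
              ((ex (bernoulliWeight p) (ind (secAt e true (U 0))) - ex (bernoulliWeight p) (ind (secAt e false (U 0))))
                * (ex (bernoulliWeight p) (ind (secAt e true (U 1))) - ex (bernoulliWeight p) (ind (secAt e false (U 1))))
                * (ex (bernoulliWeight p) (ind (secAt e true (U 2))) - ex (bernoulliWeight p) (ind (secAt e false (U 2)))))) := by
  have h := sahiE_three_sub_sq_minors_eq e U hU p
  have h1 := mixC1_sub_sahiE_eq (bernoulliWeight p) (fun j => secAt e false (U j)) (fun j => secAt e true (U j))
  -- eliminate `mixC1` and solve for `E_3(μ_p;1_U)`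
  have h2 : mixC1 (bernoulliWeight p) (fun j => secAt e false (U j)) (fun j => secAt e true (U j))
      = sahiE (bernoulliWeight p) 3 (fun j => ind (secAt e false (U j)))
        + (mixC2 (bernoulliWeight p) (fun j => secAt e false (U j)) (fun j => secAt e true (U j))
            - sahiE (bernoulliWeight p) 3 (fun j => ind (secAt e true (U j))))
        + (ex (bernoulliWeight p) (ind (secAt e true (U 0))) - ex (bernoulliWeight p) (ind (secAt e false (U 0))))
          * (ex (bernoulliWeight p) (ind (secAt e true (U 1))) - ex (bernoulliWeight p) (ind (secAt e false (U 1))))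
          * (ex (bernoulliWeight p) (ind (secAt e true (U 2))) - ex (bernoulliWeight p) (ind (secAt e false (U 2)))) := by
    linarith
  rw [h2] at h
  linear_combination h

/-! ### 2. `MD_3` along a coordinate from the single endpoint inequality -/

/-- **`MD_3` at `(U, e, p)` from ONE endpoint inequality**: if `mixC2_e(U) ≥ E_3(μ_p; U^{e←1})` then
`(1−p_e)²·E_3(U^{e←0}) + p_e²·E_3(U^{e←1}) ≤ E_3(U)` (the other endpoint inequality `mixC1_e ≥ E_3(U^{e←0})` follows by `mixC1_sub_sahiE_eq`,
since `ν_j ≥ 0` for increasing members). [this work] -/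
theorem sahiE_three_ge_sq_minors_of_mixC2_ge (e : ι) (U : Fin 3 → Set (Set ι)) (hU : ∀ j, IsUpperSet (U j)) (p : ι → unitInterval)
    (h2 : sahiE (bernoulliWeight p) 3 (fun j => ind (secAt e true (U j)))
      ≤ mixC2 (bernoulliWeight p) (fun j => secAt e false (U j)) (fun j => secAt e true (U j))) :
    (1 - (p e : ℝ)) ^ 2 * sahiE (bernoulliWeight p) 3 (fun j => ind (secAt e false (U j)))
      + (p e : ℝ) ^ 2 * sahiE (bernoulliWeight p) 3 (fun j => ind (secAt e true (U j)))
      ≤ sahiE (bernoulliWeight p) 3 (fun j => ind (U j)) := by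
  refine sahiE_three_ge_sq_minors_of_mixC_ge e U hU p ?_ h2
  have h1 := mixC1_sub_sahiE_eq (bernoulliWeight p) (fun j => secAt e false (U j)) (fun j => secAt e true (U j))
  have hν : 0 ≤ (ex (bernoulliWeight p) (ind (secAt e true (U 0))) - ex (bernoulliWeight p) (ind (secAt e false (U 0))))
      * (ex (bernoulliWeight p) (ind (secAt e true (U 1))) - ex (bernoulliWeight p) (ind (secAt e false (U 1))))
      * (ex (bernoulliWeight p) (ind (secAt e true (U 2))) - ex (bernoulliWeight p) (ind (secAt e false (U 2)))) :=
    mul_nonneg (mul_nonneg (ex_secAt_true_sub_false_nonneg p e (hU 0)) (ex_secAt_true_sub_false_nonneg p e (hU 1)))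
      (ex_secAt_true_sub_false_nonneg p e (hU 2))
  linarith

/-! ### 3. The reductions with the single hypothesis -/

/-- **Kahn's Conjecture 5 / Sahi's `C_3` for product measures from ONE endpoint inequality** (closed cube): if
`mixC2_e(U) ≥ E_3(μ_p; U^{e←1})` for every increasing triple on every finite cube, every coordinate and every parameter vector, then
`MasterFamilyNonneg 3`. [this work] -/
theorem masterFamilyNonneg_three_of_mixC2_ge
    (h : ∀ (κ : Type) [Fintype κ] (p : κ → unitInterval) (U : Fin 3 → Set (Set κ)), (∀ j, IsUpperSet (U j)) → ∀ e : κ,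
      sahiE (bernoulliWeight p) 3 (fun j => ind (secAt e true (U j)))
        ≤ mixC2 (bernoulliWeight p) (fun j => secAt e false (U j)) (fun j => secAt e true (U j))) :
    MasterFamilyNonneg 3 :=
  masterFamilyNonneg_of_explicitDomination 1 fun κ _ p U hU e => by
    simpa using sahiE_three_ge_sq_minors_of_mixC2_ge e U hU p (h κ p U hU e)

/-- **The pointwise master conjecture at order 3 from ONE endpoint inequality** (open cube): the same hypothesis at interior parameter vectors gives
`MasterFamilyEqIff 3` (`E_3(μ_p;1_U) = 0 ↔ U ∈ Z_3`, containing Kahn's Conjecture 5 in strict form). [this work] -/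
theorem masterFamilyEqIff_three_of_mixC2_ge
    (h : ∀ (κ : Type) [Fintype κ] (p : κ → unitInterval), (∀ e, (p e : ℝ) ∈ Set.Ioo (0 : ℝ) 1) →
      ∀ U : Fin 3 → Set (Set κ), (∀ j, IsUpperSet (U j)) → ∀ e : κ,
        sahiE (bernoulliWeight p) 3 (fun j => ind (secAt e true (U j)))
          ≤ mixC2 (bernoulliWeight p) (fun j => secAt e false (U j)) (fun j => secAt e true (U j))) :
    MasterFamilyEqIff 3 :=
  masterFamilyEqIff_of_explicitDomination (by norm_num) fun κ _ p hp U hU e => by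
    simpa using sahiE_three_ge_sq_minors_of_mixC2_ge e U hU p (h κ p hp U hU e)

end Pointwise

end Summit.CriticalPhenomena.PercolationContinuityZ3.Theorems

end
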